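import Summits.CriticalPhenomena.PercolationContinuityZ3.Theorems.PercNearOneGluingNoHeavyQuantAD3Frechet
import Summits.CriticalPhenomena.PercolationContinuityZ3.Theorems.PercNearOneGluingNoHeavyQuantAD3TripleSplit
import HarnessLib

/-!
# QUANT lane R8, T-DEC, ROUTE 2: `AD3FrechetCell ⟹` the pair ⊗ pair kinds of `AD3ProdCell` (kernel assembly), with the bridge
# "an admissible law on at most three atoms is AD3⁺-decomposable" in the degenerate-friendly form the Fréchet laws need

builds on p205010 (kernel theorem, internal audit signed; external expert review pending)

Support file (`--supports stmt-CriticalPhenomena-4575`), QUANT lane, LEAD seat prim-quant-lead (gen 35), rung R8; continues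
`…QuantAD3Frechet` (the Fréchet identity `{l₁,h₁;α}∗{l₂,h₂;β} = λ·frCo + (1−λ)·frCt`, the cell `AD3FrechetCell`) and typer g31's
`…QuantAD3TripleSplit` (`ad3Decomp_of_admissibleTriple`).  No definitions, no sorries, standard axioms.

* `ad3Decomp_TP_of_decAt` — an admissible pair `{lo,hi;γ}` (`lo ≤ hi ≤ M`, `0 ≤ γ ≤ 1`, `gate_q` DEC at all layers) is AD3⁺: a point
  (`lo = hi` or `γ ∈ {0,1}`), a heavy pair, or an L2 component.
* `ad3Decomp_TR_of_decAt` — an admissible three-atom pattern `TR[s₁,s₂,s₃; p]` with `s₁ < s₂ < s₃ ≤ M` and masses `pᵢ ≥ 0` (zeros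
  allowed) is AD3⁺ (zero masses collapse to the pair case; positive masses: typer's lemma);  `ad3Decomp_TR_of_decAt_top` — the same for
  atoms `u, v < w` in either order or equal (the shape of `frCt`).
* **`ad3Decomp_frCo_of_decAt`, `ad3Decomp_frCt_of_decAt`** — the two Fréchet laws are AD3⁺ as soon as they are admissible.
* **`ad3Decomp_lconv_TP_TP_of_frechetCell : AD3FrechetCell →`** for admissible top-affordable pairs `{l₁,h₁;α}`, `{l₂,h₂;β}`
  (`lᵢ ≤ hᵢ`, points included) the product is AD3⁺ at `(y, q, T₁+T₂, M₁+M₂)` — i.e. the H⊗H, H⊗L2, L2⊗L2 kinds of `AD3ProdCell`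
  (`ad3ProdCell_pairPair_of_frechetCell`, stated on `IsAD3Component` data with both components pairs).
HONEST STATUS: `AD3FrechetCell`, `AD3ProdCell` (triple kinds), `AD3GateCell`, `TreeBuiltAD3`, `FarTreeRow` OPEN; nothing here is a
published result; RATE class log\* / honest sentence unchanged.

[this work]; Fréchet–Hoeffding extremal couplings [folklore].  The gluing rows served [cite: KozmaNitzan2024, Conjecture 3 (p. 15)];
product measure [cite: Grimmett1999, §1.3 p. 10].
-/

noncomputable section

namespace Summit.CriticalPhenomena.PercolationContinuityZ3.Theorems

namespace Quant

open Finset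

/-- two-point law notation `TP[lo, hi, g, h] = g·[h = hi] + (1 − g)·[h = lo]` (as in the lane's other files). -/
local notation3 "TP[" lo ", " hi ", " g ", " h "]" =>
  (g : ℝ) * (if (h : ℕ) = (hi : ℕ) then (1 : ℝ) else 0) + (1 - (g : ℝ)) * (if (h : ℕ) = (lo : ℕ) then (1 : ℝ) else 0)

/-- three-atom law notation `TR[s₁, s₂, s₃, p₁, p₂, p₃, h] = p₁·[h = s₁] + p₂·[h = s₂] + p₃·[h = s₃]`. -/
local notation3 "TR[" s₁ ", " s₂ ", " s₃ ", " p₁ ", " p₂ ", " p₃ ", " h "]" =>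
  (p₁ : ℝ) * (if (h : ℕ) = (s₁ : ℕ) then (1 : ℝ) else 0) + (p₂ : ℝ) * (if (h : ℕ) = (s₂ : ℕ) then (1 : ℝ) else 0)
    + (p₃ : ℝ) * (if (h : ℕ) = (s₃ : ℕ) then (1 : ℝ) else 0)

namespace LawDec

/-! ### Admissible laws on at most three atoms are AD3⁺ -/

/-- a point mass at `s ≤ M` equals the pattern `TP[lo, hi, γ]` whenever `lo = hi = s`, or `γ = 1, hi = s`, or `γ = 0, lo = s`; here:
the point mass itself is AD3⁺ at mean `s` (`y ≤ q`). [this work] -/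
theorem ad3Decomp_point (y q : ℝ) (M s : ℕ) (hs : s ≤ M) (hyq : y ≤ q) :
    AD3Decomp y q (s : ℝ) M (fun h => if h = s then (1 : ℝ) else 0) :=
  ad3Decomp_of_component (isAD3Component_point y q M s hs hyq)

/-- **an admissible pair is AD3⁺**: `{lo,hi;γ}` with `lo ≤ hi ≤ M`, `0 ≤ γ ≤ 1`, mean `T = lo + (hi−lo)γ`, `gate_q` DEC at every
layer `j′ < M` (floor `0 < y ≤ q`) — a point mass, a heavy pair or an admissible light pair. [this work] -/
theorem ad3Decomp_TP_of_decAt (y q T γ : ℝ) (M lo hi : ℕ) (hyq : y ≤ q) (hlohi : lo ≤ hi) (hhi : hi ≤ M)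
    (hγ0 : 0 ≤ γ) (hγ1 : γ ≤ 1) (hT : (lo : ℝ) + ((hi : ℝ) - lo) * γ = T)
    (hD : ∀ j', j' < M → DECAt y j' M (gate (fun h => TP[lo, hi, γ, h]) q)) :
    AD3Decomp y q T M (fun h => TP[lo, hi, γ, h]) := by
  rcases Nat.eq_or_lt_of_le hlohi with heq | hlt
  · -- point mass at `lo = hi`
    subst heq
    have e : (fun h : ℕ => TP[lo, lo, γ, h]) = fun h => if h = lo then (1 : ℝ) else 0 := by
      funext h; ring
    have eT : T = (lo : ℝ) := by rw [← hT]; ring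
    rw [e, eT]; exact ad3Decomp_point y q M lo hhi hyq
  rcases eq_or_lt_of_le hγ1 with hg1 | hg1
  · -- `γ = 1`: point mass at `hi`
    subst hg1
    have e : (fun h : ℕ => TP[lo, hi, (1 : ℝ), h]) = fun h => if h = hi then (1 : ℝ) else 0 := by
      funext h; ring
    have eT : T = (hi : ℝ) := by rw [← hT]; ring
    rw [e, eT]; exact ad3Decomp_point y q M hi hhi hyq
  rcases eq_or_lt_of_le hγ0 with hg0 | hg0
  · -- `γ = 0`: point mass at `lo`
    subst hg0
    have e : (fun h : ℕ => TP[lo, hi, (0 : ℝ), h]) = fun h => if h = lo then (1 : ℝ) else 0 := by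
      funext h; ring
    have eT : T = (lo : ℝ) := by rw [← hT]; ring
    rw [e, eT]; exact ad3Decomp_point y q M lo (hlohi.trans hhi) hyq
  by_cases hheavy : y ≤ q * γ
  · exact ad3Decomp_of_component (Or.inl ⟨lo, hi, γ, hlohi, hhi, hγ0, hγ1, hheavy, hT, rfl⟩)
  · exact ad3Decomp_of_component (Or.inr (Or.inl ⟨lo, hi, γ, hlt, hhi, hγ0, hγ1, lt_of_not_ge hheavy, hT, hD, rfl⟩))

/-- **an admissible three-atom pattern with sorted atoms is AD3⁺**: `s₁ < s₂ < s₃ ≤ M`, masses `pᵢ ≥ 0` (zeros allowed) summing to `1`,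
mean `T`, `gate_q TR` DEC at every layer `j′ < M`, floor `0 < y ≤ q`.  Zero masses collapse the pattern to a pair (`ad3Decomp_TP_of_decAt`);
all masses positive is typer g31's `ad3Decomp_of_admissibleTriple`. [this work] -/
theorem ad3Decomp_TR_of_decAt (y q T p₁ p₂ p₃ : ℝ) (M s₁ s₂ s₃ : ℕ) (hy0 : 0 < y) (hyq : y ≤ q)
    (h12 : s₁ < s₂) (h23 : s₂ < s₃) (h3 : s₃ ≤ M) (hp₁ : 0 ≤ p₁) (hp₂ : 0 ≤ p₂) (hp₃ : 0 ≤ p₃) (hp : p₁ + p₂ + p₃ = 1)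
    (hT : p₁ * (s₁ : ℝ) + p₂ * (s₂ : ℝ) + p₃ * (s₃ : ℝ) = T)
    (hD : ∀ j', j' < M → DECAt y j' M (gate (fun h => TR[s₁, s₂, s₃, p₁, p₂, p₃, h]) q)) :
    AD3Decomp y q T M (fun h => TR[s₁, s₂, s₃, p₁, p₂, p₃, h]) := by
  rcases eq_or_lt_of_le hp₁ with hz₁ | hpos₁
  · -- `p₁ = 0`: the pair `{s₂, s₃; p₃}`
    subst hz₁
    have hp' : p₂ = 1 - p₃ := by linarith
    have e : (fun h : ℕ => TR[s₁, s₂, s₃, (0 : ℝ), p₂, p₃, h]) = fun h => TP[s₂, s₃, p₃, h] := by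
      funext h; rw [hp']; ring
    rw [e] at hD ⊢
    refine ad3Decomp_TP_of_decAt y q T p₃ M s₂ s₃ hyq h23.le h3 hp₃ (by linarith) ?_ hD
    rw [← hT, hp']; ring
  rcases eq_or_lt_of_le hp₂ with hz₂ | hpos₂
  · -- `p₂ = 0`: the pair `{s₁, s₃; p₃}`
    subst hz₂
    have hp' : p₁ = 1 - p₃ := by linarith
    have e : (fun h : ℕ => TR[s₁, s₂, s₃, p₁, (0 : ℝ), p₃, h]) = fun h => TP[s₁, s₃, p₃, h] := by
      funext h; rw [hp']; ring
    rw [e] at hD ⊢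
    refine ad3Decomp_TP_of_decAt y q T p₃ M s₁ s₃ hyq (h12.trans h23).le h3 hp₃ (by linarith) ?_ hD
    rw [← hT, hp']; ring
  rcases eq_or_lt_of_le hp₃ with hz₃ | hpos₃
  · -- `p₃ = 0`: the pair `{s₁, s₂; p₂}`
    subst hz₃
    have hp' : p₁ = 1 - p₂ := by linarith
    have e : (fun h : ℕ => TR[s₁, s₂, s₃, p₁, p₂, (0 : ℝ), h]) = fun h => TP[s₁, s₂, p₂, h] := by
      funext h; rw [hp']; ring
    rw [e] at hD ⊢
    refine ad3Decomp_TP_of_decAt y q T p₂ M s₁ s₂ hyq h12.le (h23.le.trans h3) hp₂ (by linarith) ?_ hD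
    rw [← hT, hp']; ring
  exact ad3Decomp_of_admissibleTriple y q T M s₁ s₂ s₃ p₁ p₂ p₃ hy0 hyq h12 h23 h3 hpos₁ hpos₂ hpos₃ hp hT hD

/-- the three-atom pattern with two LOWER atoms `u, v` below a top `w` (`u, v < w ≤ M`, any order, possibly `u = v`) — the shape of
`frCt` for `α+β ≥ 1` — is AD3⁺ when admissible (same data). [this work] -/
theorem ad3Decomp_TR_of_decAt_top (y q T p₁ p₂ p₃ : ℝ) (M u v w : ℕ) (hy0 : 0 < y) (hyq : y ≤ q)
    (huw : u < w) (hvw : v < w) (hw : w ≤ M) (hp₁ : 0 ≤ p₁) (hp₂ : 0 ≤ p₂) (hp₃ : 0 ≤ p₃) (hp : p₁ + p₂ + p₃ = 1)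
    (hT : p₁ * (u : ℝ) + p₂ * (v : ℝ) + p₃ * (w : ℝ) = T)
    (hD : ∀ j', j' < M → DECAt y j' M (gate (fun h => TR[u, v, w, p₁, p₂, p₃, h]) q)) :
    AD3Decomp y q T M (fun h => TR[u, v, w, p₁, p₂, p₃, h]) := by
  rcases lt_trichotomy u v with huv | huv | huv
  · exact ad3Decomp_TR_of_decAt y q T p₁ p₂ p₃ M u v w hy0 hyq huv hvw hw hp₁ hp₂ hp₃ hp hT hD
  · -- `u = v`: the pair `{u, w; p₃}`
    subst huv
    have e : (fun h : ℕ => TR[u, u, w, p₁, p₂, p₃, h]) = fun h => TP[u, w, p₃, h] := by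
      funext h
      have : p₁ + p₂ = 1 - p₃ := by linarith
      linear_combination (if h = u then (1 : ℝ) else 0) * this
    rw [e] at hD ⊢
    have hp' : p₁ + p₂ = 1 - p₃ := by linarith
    refine ad3Decomp_TP_of_decAt y q T p₃ M u w hyq huw.le hw hp₃ (by linarith) ?_ hD
    rw [← hT]; linear_combination (-(u : ℝ)) * hp'
  · -- `v < u`: swap the first two atoms
    have e : (fun h : ℕ => TR[u, v, w, p₁, p₂, p₃, h]) = fun h => TR[v, u, w, p₂, p₁, p₃, h] := by
      funext h; ring
    rw [e] at hD ⊢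
    exact ad3Decomp_TR_of_decAt y q T p₂ p₁ p₃ M v u w hy0 hyq huv huw hw hp₂ hp₁ hp₃ (by linarith) (by linarith) hD

/-- the three-atom pattern with one BOTTOM atom `a` below two atoms `u, v` (`a < u, v ≤ M`, any order, possibly `u = v`) — the shape of
`frCt` for `α+β < 1` — is AD3⁺ when admissible. [this work] -/
theorem ad3Decomp_TR_of_decAt_bottom (y q T p₁ p₂ p₃ : ℝ) (M a u v : ℕ) (hy0 : 0 < y) (hyq : y ≤ q)
    (hau : a < u) (hav : a < v) (hu : u ≤ M) (hv : v ≤ M) (hp₁ : 0 ≤ p₁) (hp₂ : 0 ≤ p₂) (hp₃ : 0 ≤ p₃) (hp : p₁ + p₂ + p₃ = 1)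
    (hT : p₁ * (a : ℝ) + p₂ * (u : ℝ) + p₃ * (v : ℝ) = T)
    (hD : ∀ j', j' < M → DECAt y j' M (gate (fun h => TR[a, u, v, p₁, p₂, p₃, h]) q)) :
    AD3Decomp y q T M (fun h => TR[a, u, v, p₁, p₂, p₃, h]) := by
  rcases lt_trichotomy u v with huv | huv | huv
  · exact ad3Decomp_TR_of_decAt y q T p₁ p₂ p₃ M a u v hy0 hyq hau huv hv hp₁ hp₂ hp₃ hp hT hD
  · -- `u = v`: the pair `{a, u; p₂ + p₃}`
    subst huv
    have e : (fun h : ℕ => TR[a, u, u, p₁, p₂, p₃, h]) = fun h => TP[a, u, p₂ + p₃, h] := by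
      funext h
      have : p₁ = 1 - (p₂ + p₃) := by linarith
      rw [this]; ring
    rw [e] at hD ⊢
    have hp' : p₁ = 1 - (p₂ + p₃) := by linarith
    refine ad3Decomp_TP_of_decAt y q T (p₂ + p₃) M a u hyq hau.le hu (by linarith) (by linarith) ?_ hD
    rw [← hT, hp']; ring
  · -- `v < u`: swap the last two atoms
    have e : (fun h : ℕ => TR[a, u, v, p₁, p₂, p₃, h]) = fun h => TR[a, v, u, p₁, p₃, p₂, h] := by
      funext h; ring
    rw [e] at hD ⊢
    exact ad3Decomp_TR_of_decAt y q T p₁ p₃ p₂ M a v u hy0 hyq hav huv hu hp₁ hp₃ hp₂ (by linarith) (by linarith) hD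

/-! ### The Fréchet laws are AD3⁺ when admissible -/

/-- **`frCo` admissible ⟹ AD3⁺** (pairs `lᵢ < hᵢ`, `h₁ + h₂ ≤ M`, gates in `[0,1]`, `T = T₁ + T₂`). [this work] -/
theorem ad3Decomp_frCo_of_decAt (y q α β : ℝ) (M l₁ h₁ l₂ h₂ : ℕ) (hy0 : 0 < y) (hyq : y ≤ q)
    (hl₁ : l₁ < h₁) (hl₂ : l₂ < h₂) (hM : h₁ + h₂ ≤ M) (hα0 : 0 ≤ α) (hα1 : α ≤ 1) (hβ0 : 0 ≤ β) (hβ1 : β ≤ 1)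
    (hD : ∀ j', j' < M → DECAt y j' M (gate (frCo l₁ h₁ l₂ h₂ α β) q)) :
    AD3Decomp y q (((l₁ : ℝ) + ((h₁ : ℝ) - l₁) * α) + ((l₂ : ℝ) + ((h₂ : ℝ) - l₂) * β)) M (frCo l₁ h₁ l₂ h₂ α β) := by
  by_cases hab : α ≤ β
  · have ef : frCo l₁ h₁ l₂ h₂ α β = fun h => TR[l₁ + l₂, l₁ + h₂, h₁ + h₂, 1 - β, β - α, α, h] := by
      funext h; simp only [frCo, if_pos hab]
    rw [ef] at hD ⊢
    exact ad3Decomp_TR_of_decAt y q _ (1 - β) (β - α) α M (l₁ + l₂) (l₁ + h₂) (h₁ + h₂) hy0 hyq (by omega) (by omega) hM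
      (by linarith) (by linarith) hα0 (by ring) (by push_cast; ring) hD
  · rw [not_le] at hab
    have ef : frCo l₁ h₁ l₂ h₂ α β = fun h => TR[l₁ + l₂, h₁ + l₂, h₁ + h₂, 1 - α, α - β, β, h] := by
      funext h; simp only [frCo, if_neg (not_le.2 hab)]
    rw [ef] at hD ⊢
    exact ad3Decomp_TR_of_decAt y q _ (1 - α) (α - β) β M (l₁ + l₂) (h₁ + l₂) (h₁ + h₂) hy0 hyq (by omega) (by omega) hM
      (by linarith) (by linarith) hβ0 (by ring) (by push_cast; ring) hD

/-- **`frCt` admissible ⟹ AD3⁺** (same data). [this work] -/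
theorem ad3Decomp_frCt_of_decAt (y q α β : ℝ) (M l₁ h₁ l₂ h₂ : ℕ) (hy0 : 0 < y) (hyq : y ≤ q)
    (hl₁ : l₁ < h₁) (hl₂ : l₂ < h₂) (hM : h₁ + h₂ ≤ M) (hα0 : 0 ≤ α) (hα1 : α ≤ 1) (hβ0 : 0 ≤ β) (hβ1 : β ≤ 1)
    (hD : ∀ j', j' < M → DECAt y j' M (gate (frCt l₁ h₁ l₂ h₂ α β) q)) :
    AD3Decomp y q (((l₁ : ℝ) + ((h₁ : ℝ) - l₁) * α) + ((l₂ : ℝ) + ((h₂ : ℝ) - l₂) * β)) M (frCt l₁ h₁ l₂ h₂ α β) := by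
  by_cases hab : 1 ≤ α + β
  · have ef : frCt l₁ h₁ l₂ h₂ α β = fun h => TR[l₁ + h₂, h₁ + l₂, h₁ + h₂, 1 - α, 1 - β, α + β - 1, h] := by
      funext h; simp only [frCt, if_pos hab]
    rw [ef] at hD ⊢
    exact ad3Decomp_TR_of_decAt_top y q _ (1 - α) (1 - β) (α + β - 1) M (l₁ + h₂) (h₁ + l₂) (h₁ + h₂) hy0 hyq (by omega)
      (by omega) hM (by linarith) (by linarith) (by linarith) (by ring) (by push_cast; ring) hD
  · rw [not_le] at hab
    have ef : frCt l₁ h₁ l₂ h₂ α β = fun h => TR[l₁ + l₂, l₁ + h₂, h₁ + l₂, 1 - α - β, β, α, h] := by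
      funext h; simp only [frCt, if_neg (not_le.2 hab)]
    rw [ef] at hD ⊢
    exact ad3Decomp_TR_of_decAt_bottom y q _ (1 - α - β) β α M (l₁ + l₂) (l₁ + h₂) (h₁ + l₂) hy0 hyq (by omega) (by omega)
      (by omega) (by omega) (by linarith) hβ0 hα0 (by ring) (by push_cast; ring) hD

/-! ### The pair ⊗ pair kinds of `AD3ProdCell` from the cell -/

/-- **`AD3FrechetCell ⟹` the product of two admissible top-affordable GENUINE pairs (`lᵢ < hᵢ`) is AD3⁺.** [this work] -/
theorem ad3Decomp_lconv_TP_TP_of_frechetCell (hFC : AD3FrechetCell) (y q α β : ℝ) (M₁ M₂ l₁ h₁ l₂ h₂ : ℕ)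
    (hy0 : 0 < y) (hyq : y < q) (hq1 : q ≤ 1) (hl₁ : l₁ < h₁) (hh₁ : h₁ ≤ M₁) (hl₂ : l₂ < h₂) (hh₂ : h₂ ≤ M₂)
    (hα0 : 0 ≤ α) (hα1 : α ≤ 1) (hβ0 : 0 ≤ β) (hβ1 : β ≤ 1)
    (hta₁ : y * (M₁ : ℝ) ≤ q * ((l₁ : ℝ) + ((h₁ : ℝ) - l₁) * α)) (hta₂ : y * (M₂ : ℝ) ≤ q * ((l₂ : ℝ) + ((h₂ : ℝ) - l₂) * β))
    (hD₁ : ∀ j', j' < M₁ → DECAt y j' M₁ (gate (fun h => TP[l₁, h₁, α, h]) q))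
    (hD₂ : ∀ j', j' < M₂ → DECAt y j' M₂ (gate (fun h => TP[l₂, h₂, β, h]) q)) :
    AD3Decomp y q (((l₁ : ℝ) + ((h₁ : ℝ) - l₁) * α) + ((l₂ : ℝ) + ((h₂ : ℝ) - l₂) * β)) (M₁ + M₂)
      (lconv M₁ M₂ (fun k => TP[l₁, h₁, α, k]) (fun k => TP[l₂, h₂, β, k])) := by
  obtain ⟨hco, hct⟩ := hFC y q α β M₁ M₂ l₁ h₁ l₂ h₂ hy0 hyq hq1 hl₁ hh₁ hl₂ hh₂ hα0 hα1 hβ0 hβ1 hta₁ hta₂ hD₁ hD₂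
  exact ad3Decomp_lconv_TP_TP_of_frechet y q _ α β M₁ M₂ l₁ h₁ l₂ h₂ hl₁.le hh₁ hl₂.le hh₂ hα0 hα1 hβ0 hβ1
    (ad3Decomp_frCo_of_decAt y q α β (M₁ + M₂) l₁ h₁ l₂ h₂ hy0 hyq.le hl₁ hl₂ (by omega) hα0 hα1 hβ0 hβ1 hco)
    (ad3Decomp_frCt_of_decAt y q α β (M₁ + M₂) l₁ h₁ l₂ h₂ hy0 hyq.le hl₁ hl₂ (by omega) hα0 hα1 hβ0 hβ1 hct)

/-- a possibly DEGENERATE admissible top-affordable pair `{lo,hi;γ}` (`lo ≤ hi`) is, as a law, a GENUINE admissible top-affordable pair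
`{lo′,hi′;γ′}` with `lo′ < hi′ ≤ M` and the same mean — unless it is the point mass at `0` (then `M = 0` by top-affordability).
Used to feed point components into the Fréchet cell. [this work] -/
theorem exists_genuine_TP (y q γ : ℝ) (M lo hi : ℕ) (hy0 : 0 < y) (hy1 : y < 1) (hq0 : 0 < q) (hq1 : q ≤ 1) (hyq : y ≤ q)
    (hlohi : lo ≤ hi) (hhi : hi ≤ M) (hγ0 : 0 ≤ γ) (hγ1 : γ ≤ 1)
    (hta : y * (M : ℝ) ≤ q * ((lo : ℝ) + ((hi : ℝ) - lo) * γ))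
    (hD : ∀ j', j' < M → DECAt y j' M (gate (fun h => TP[lo, hi, γ, h]) q)) :
    (M = 0 ∧ (fun h : ℕ => TP[lo, hi, γ, h]) = fun h => if h = 0 then (1 : ℝ) else 0) ∨
    ∃ (lo' hi' : ℕ) (γ' : ℝ), lo' < hi' ∧ hi' ≤ M ∧ 0 ≤ γ' ∧ γ' ≤ 1 ∧
      (lo' : ℝ) + ((hi' : ℝ) - lo') * γ' = (lo : ℝ) + ((hi : ℝ) - lo) * γ ∧
      (fun h : ℕ => TP[lo, hi, γ, h]) = (fun h => TP[lo', hi', γ', h]) ∧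
      (∀ j', j' < M → DECAt y j' M (gate (fun h => TP[lo', hi', γ', h]) q)) := by
  rcases Nat.eq_or_lt_of_le hlohi with heq | hlt
  · -- point mass at `s = lo = hi`
    subst heq
    rcases Nat.eq_zero_or_pos lo with hs | hs
    · subst hs
      left
      have hM : M = 0 := by
        have h1 : y * (M : ℝ) ≤ 0 := by simpa using hta
        have h2 : (M : ℝ) ≤ 0 := by
          by_contra hlt'; rw [not_le] at hlt'
          linarith [mul_pos hy0 hlt']
        exact_mod_cast le_antisymm h2 (Nat.cast_nonneg M)
      refine ⟨hM, ?_⟩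
      funext h; ring
    · right
      -- `δ_s = {0, s; 1}`, a heavy zero pair
      have e : (fun h : ℕ => TP[lo, lo, γ, h]) = fun h => TP[0, lo, (1 : ℝ), h] := by
        funext h; ring
      have hmean : ((0 : ℕ) : ℝ) + ((lo : ℝ) - (0 : ℕ)) * 1 = (lo : ℝ) + ((lo : ℝ) - lo) * γ := by push_cast; ring
      refine ⟨0, lo, 1, hs, hhi, zero_le_one, le_rfl, hmean, e, ?_⟩
      have hta' : y * (M : ℝ) ≤ q * (((0 : ℕ) : ℝ) + ((lo : ℝ) - (0 : ℕ)) * 1) := by rw [hmean]; exact hta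
      exact heavyPair_gate_decAt y q 1 M 0 lo hy0 hy1 hq0 hq1 (Nat.zero_le _) hhi le_rfl (by linarith) hta'
  · right
    exact ⟨lo, hi, γ, hlt, hhi, hγ0, hγ1, rfl, rfl, hD⟩

/-- **`AD3FrechetCell ⟹` the product of two admissible top-affordable pairs (`lᵢ ≤ hᵢ`, point components included) is AD3⁺.**
[this work] -/
theorem ad3Decomp_lconv_pairs_of_frechetCell (hFC : AD3FrechetCell) (y q α β : ℝ) (M₁ M₂ l₁ h₁ l₂ h₂ : ℕ)
    (hy0 : 0 < y) (hyq : y < q) (hq1 : q ≤ 1) (hl₁ : l₁ ≤ h₁) (hh₁ : h₁ ≤ M₁) (hl₂ : l₂ ≤ h₂) (hh₂ : h₂ ≤ M₂)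
    (hα0 : 0 ≤ α) (hα1 : α ≤ 1) (hβ0 : 0 ≤ β) (hβ1 : β ≤ 1)
    (hta₁ : y * (M₁ : ℝ) ≤ q * ((l₁ : ℝ) + ((h₁ : ℝ) - l₁) * α)) (hta₂ : y * (M₂ : ℝ) ≤ q * ((l₂ : ℝ) + ((h₂ : ℝ) - l₂) * β))
    (hD₁ : ∀ j', j' < M₁ → DECAt y j' M₁ (gate (fun h => TP[l₁, h₁, α, h]) q))
    (hD₂ : ∀ j', j' < M₂ → DECAt y j' M₂ (gate (fun h => TP[l₂, h₂, β, h]) q)) :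
    AD3Decomp y q (((l₁ : ℝ) + ((h₁ : ℝ) - l₁) * α) + ((l₂ : ℝ) + ((h₂ : ℝ) - l₂) * β)) (M₁ + M₂)
      (lconv M₁ M₂ (fun k => TP[l₁, h₁, α, k]) (fun k => TP[l₂, h₂, β, k])) := by
  have hq0 : 0 < q := lt_trans hy0 hyq
  have hy1 : y < 1 := lt_of_lt_of_le hyq hq1
  -- the TP laws vanish above their tops
  have hz₁ : ∀ h, M₁ < h → TP[l₁, h₁, α, h] = 0 := fun h hh => by
    rw [if_neg (by omega), if_neg (by omega)]; ring
  have hz₂ : ∀ h, M₂ < h → TP[l₂, h₂, β, h] = 0 := fun h hh => by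
    rw [if_neg (by omega), if_neg (by omega)]; ring
  rcases exists_genuine_TP y q α M₁ l₁ h₁ hy0 hy1 hq0 hq1 hyq.le hl₁ hh₁ hα0 hα1 hta₁ hD₁ with ⟨hM₁, e₁⟩ |
      ⟨l₁', h₁', α', hl₁', hh₁', hα0', hα1', hm₁, e₁, hD₁'⟩
  · -- first factor is `δ₀` on `{0}`: the product is the second factor
    subst hM₁
    have eT : ((l₁ : ℝ) + ((h₁ : ℝ) - l₁) * α) = 0 := by
      obtain ⟨-, -, -, d⟩ := tp_laws 0 l₁ h₁ α hα0 hα1 hl₁ hh₁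
      rw [Finset.sum_range_one, Nat.cast_zero, zero_mul] at d
      exact d.symm
    have ep : lconv 0 M₂ (fun k => TP[l₁, h₁, α, k]) (fun k => TP[l₂, h₂, β, k]) = fun k => TP[l₂, h₂, β, k] := by
      rw [e₁]; funext h
      rw [lconv_point_left 0 M₂ _ hz₂ h, if_pos (Nat.zero_le _), Nat.sub_zero]
    rw [ep, eT, zero_add, Nat.zero_add]
    exact ad3Decomp_TP_of_decAt y q _ β M₂ l₂ h₂ hyq.le hl₂ hh₂ hβ0 hβ1 rfl hD₂
  rcases exists_genuine_TP y q β M₂ l₂ h₂ hy0 hy1 hq0 hq1 hyq.le hl₂ hh₂ hβ0 hβ1 hta₂ hD₂ with ⟨hM₂, e₂⟩ |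
      ⟨l₂', h₂', β', hl₂', hh₂', hβ0', hβ1', hm₂, e₂, hD₂'⟩
  · subst hM₂
    have eT : ((l₂ : ℝ) + ((h₂ : ℝ) - l₂) * β) = 0 := by
      obtain ⟨-, -, -, d⟩ := tp_laws 0 l₂ h₂ β hβ0 hβ1 hl₂ hh₂
      rw [Finset.sum_range_one, Nat.cast_zero, zero_mul] at d
      exact d.symm
    have ep : lconv M₁ 0 (fun k => TP[l₁, h₁, α, k]) (fun k => TP[l₂, h₂, β, k]) = fun k => TP[l₁, h₁, α, k] := by
      rw [e₂, lconv_comm]; funext h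
      rw [lconv_point_left 0 M₁ _ hz₁ h, if_pos (Nat.zero_le _), Nat.sub_zero]
    rw [ep, eT, add_zero, Nat.add_zero]
    exact ad3Decomp_TP_of_decAt y q _ α M₁ l₁ h₁ hyq.le hl₁ hh₁ hα0 hα1 rfl hD₁
  -- both genuine
  rw [e₁, e₂, ← hm₁, ← hm₂]
  rw [← hm₁] at hta₁; rw [← hm₂] at hta₂
  exact ad3Decomp_lconv_TP_TP_of_frechetCell hFC y q α' β' M₁ M₂ l₁' h₁' l₂' h₂' hy0 hyq hq1 hl₁' hh₁' hl₂' hh₂' hα0' hα1'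
    hβ0' hβ1' hta₁ hta₂ hD₁' hD₂'

/-- **`AD3FrechetCell ⟹` THE PAIR ⊗ PAIR KINDS OF `AD3ProdCell`**: for AD3⁺ components `ω₁`, `ω₂` that are PAIRS (heavy or admissible
light — the first two alternatives of `IsAD3Component`), top-affordable, at `0 < y < q ≤ 1`, the product is AD3⁺ at
`(y, q, T₁+T₂, M₁+M₂)`. [this work] -/
theorem ad3ProdCell_pairPair_of_frechetCell (hFC : AD3FrechetCell) (y q T₁ T₂ : ℝ) (M₁ M₂ : ℕ) (ω₁ ω₂ : ℕ → ℝ)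
    (hy0 : 0 < y) (hyq : y < q) (hq1 : q ≤ 1) (hta₁ : y * (M₁ : ℝ) ≤ q * T₁) (hta₂ : y * (M₂ : ℝ) ≤ q * T₂)
    (h₁ : (∃ (lo hi : ℕ) (γ : ℝ), lo ≤ hi ∧ hi ≤ M₁ ∧ 0 ≤ γ ∧ γ ≤ 1 ∧ y ≤ q * γ ∧
        (lo : ℝ) + ((hi : ℝ) - lo) * γ = T₁ ∧ ω₁ = fun h => TP[lo, hi, γ, h]) ∨
      (∃ (lo hi : ℕ) (γ : ℝ), lo < hi ∧ hi ≤ M₁ ∧ 0 ≤ γ ∧ γ ≤ 1 ∧ q * γ < y ∧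
        (lo : ℝ) + ((hi : ℝ) - lo) * γ = T₁ ∧ (∀ j', j' < M₁ → DECAt y j' M₁ (gate (fun h => TP[lo, hi, γ, h]) q)) ∧
        ω₁ = fun h => TP[lo, hi, γ, h]))
    (h₂ : (∃ (lo hi : ℕ) (γ : ℝ), lo ≤ hi ∧ hi ≤ M₂ ∧ 0 ≤ γ ∧ γ ≤ 1 ∧ y ≤ q * γ ∧
        (lo : ℝ) + ((hi : ℝ) - lo) * γ = T₂ ∧ ω₂ = fun h => TP[lo, hi, γ, h]) ∨
      (∃ (lo hi : ℕ) (γ : ℝ), lo < hi ∧ hi ≤ M₂ ∧ 0 ≤ γ ∧ γ ≤ 1 ∧ q * γ < y ∧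
        (lo : ℝ) + ((hi : ℝ) - lo) * γ = T₂ ∧ (∀ j', j' < M₂ → DECAt y j' M₂ (gate (fun h => TP[lo, hi, γ, h]) q)) ∧
        ω₂ = fun h => TP[lo, hi, γ, h])) :
    AD3Decomp y q (T₁ + T₂) (M₁ + M₂) (lconv M₁ M₂ ω₁ ω₂) := by
  have hq0 : 0 < q := lt_trans hy0 hyq
  have hy1 : y < 1 := lt_of_lt_of_le hyq hq1
  -- extract admissible pair data from either alternative
  have ex₁ : ∃ (lo hi : ℕ) (γ : ℝ), lo ≤ hi ∧ hi ≤ M₁ ∧ 0 ≤ γ ∧ γ ≤ 1 ∧ (lo : ℝ) + ((hi : ℝ) - lo) * γ = T₁ ∧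
      (ω₁ = fun h => TP[lo, hi, γ, h]) ∧ (∀ j', j' < M₁ → DECAt y j' M₁ (gate (fun h => TP[lo, hi, γ, h]) q)) := by
    rcases h₁ with ⟨lo, hi, γ, a, b, c, d, hh, e, f⟩ | ⟨lo, hi, γ, a, b, c, d, -, e, hD, f⟩
    · exact ⟨lo, hi, γ, a, b, c, d, e, f,
        heavyPair_gate_decAt y q γ M₁ lo hi hy0 hy1 hq0 hq1 a b d hh (by rw [e]; exact hta₁)⟩
    · exact ⟨lo, hi, γ, a.le, b, c, d, e, f, hD⟩
  have ex₂ : ∃ (lo hi : ℕ) (γ : ℝ), lo ≤ hi ∧ hi ≤ M₂ ∧ 0 ≤ γ ∧ γ ≤ 1 ∧ (lo : ℝ) + ((hi : ℝ) - lo) * γ = T₂ ∧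
      (ω₂ = fun h => TP[lo, hi, γ, h]) ∧ (∀ j', j' < M₂ → DECAt y j' M₂ (gate (fun h => TP[lo, hi, γ, h]) q)) := by
    rcases h₂ with ⟨lo, hi, γ, a, b, c, d, hh, e, f⟩ | ⟨lo, hi, γ, a, b, c, d, -, e, hD, f⟩
    · exact ⟨lo, hi, γ, a, b, c, d, e, f,
        heavyPair_gate_decAt y q γ M₂ lo hi hy0 hy1 hq0 hq1 a b d hh (by rw [e]; exact hta₂)⟩
    · exact ⟨lo, hi, γ, a.le, b, c, d, e, f, hD⟩
  obtain ⟨l₁, h₁', α, hl₁, hh₁, hα0, hα1, hm₁, hω₁, hD₁⟩ := ex₁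
  obtain ⟨l₂, h₂', β, hl₂, hh₂, hβ0, hβ1, hm₂, hω₂, hD₂⟩ := ex₂
  subst hω₁ hω₂
  rw [← hm₁, ← hm₂]
  rw [← hm₁] at hta₁; rw [← hm₂] at hta₂
  exact ad3Decomp_lconv_pairs_of_frechetCell hFC y q α β M₁ M₂ l₁ h₁' l₂ h₂' hy0 hyq hq1 hl₁ hh₁ hl₂ hh₂ hα0 hα1 hβ0 hβ1
    hta₁ hta₂ hD₁ hD₂

end LawDec

end Quant

end Summit.CriticalPhenomena.PercolationContinuityZ3.Theorems
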